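import Summits.BirchSwinnertonDyer.BirchSwinnertonDyer.Theorems.PotentiallySupersingularLocalTowerTorsionFiniteHolds
import Summits.BirchSwinnertonDyer.BirchSwinnertonDyer.Theorems.AdditivePotSupersingularControlOfFacts
import Literature.NumberTheory.EllipticCurves.IwasawaTowerTorsionPotGoodLocal
import Literature.NumberTheory.EllipticCurves.IsogenyDualProofs
import Mathlib.NumberTheory.Padics.HeightOneSpectrum
import HarnessLib

/-!
# Imai's finiteness `W(ℚ_{p,∞})[p^∞] < ∞` IS A TREE THEOREM on every potentially SUPERSINGULAR row — the displayed
# `hImai` / `hfin` schema of crux M's closers discharged on ALL K9 (wild `3`, `ClassO6`) and ALL K8-t′ (tame (t′),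
# `ClassO5 ⊇ Addv ∧ SubTprime`) rows, for EVERY `ℤ_p`-extension, and at Kato's isogenous member
# (route-free helper for crux M = stmt-BirchSwinnertonDyer-19196 `ReducibleKatoMember`, K9 / K8-t′; seat `bsd-potss-rkm` g31)

WHY.  After seat g30 (p677595 / p678466) crux M and U₀-red rest, in the kernel, on {modularity, the hull sub-package
`Kato2004.exists_memberHullZetaFineInputs`, H2X⁺ `Kato2004.exists_iwasawaH2Data_fineSelmerDual_embedding_count`,
Ferrero–Washington, Lim 2017 Thm. 3.5} ⊕ ONE local input: Imai 1975 — the finiteness of `W_K(ℚ_{p,∞})[p^∞]` at the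
potentially good additive `p` (named fact `imai1975_finite_fixedPoints_kerSubgroup_inf_decomp_of_padicValRat_j_nonneg`,
p678243; hypothesis `hfin` of H2X / H2X⁺).  g30 recorded it as "not provable in the tree (no formal groups over ramified
bases, no Sen theory)".  BUT THE TREE ALREADY PROVES IT on the potentially SUPERSINGULAR rows — which are ALL the rows
the two routes touch (K9: `ClassO6 W 3`; K8-t′: `Addv W p ∧ SubTprime W p`): cell `bsd-wall` (seat utd-p3 g5) landed
Serre 1967 §5 Prop. 8 as `Serre1967.noStableDivisibleLine_of_potentiallySupersingular_holds` (division-polynomial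
contraction over ANY finite extension of `ℚ_p`, no restriction on the ramification index), and seat `bsd-potss-kmc`
g16/g17 the line-free reduction `WeierstrassCurve.localTowerTorsionFiniteAt_of_noStableDivisibleLine` — in the
dialect `SchneiderFreeControlAtoms.LocalTowerTorsionFiniteAt (W.baseChange K) p κ 𝔭` over a number field `K`.
THIS FILE is the bridge to the cyclotomic/`ℚ`-level dialect of Kato's consumers and to Kato's member:

* §1 `finite_fixedPoints_kerSubgroup_inf_decomp_of_potentiallySupersingular` — for `W/ℚ`, an ODD prime `p` with
  `0 ≤ ord_p j(W)` and NO unit root at any good place above `p` of any number field (potentially supersingular), EVERY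
  `ℤ_p`-extension `κ` of `ℚ` (not only the cyclotomic one) and the place `v` of `ℚ` at `p`:
  `Finite (FixedPoints.addSubgroup ↥(κ.kerSubgroup ⊓ GreenbergSelmer.decomp v) (W.geomPrimaryTorsion p))` — VERBATIM
  the conclusion of the Imai fact / the `hfin` of H2X⁺ (instance `K = ℚ` of the kmc reduction: `W.baseChange ℚ = W`;
  the moved `p`-torsion point from `ℚ_v ≃ ℚ_p ⊅ μ_p`, Mathlib `Rat.HeightOneSpectrum.adicCompletion.padicEquiv`);
* §2 `finite_fixedPoints_of_isogeny` / `…_of_isIsogenous` — the finiteness TRANSPORTS along a `ℚ`-isogeny (an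
  isogeny is a `Γ_ℚ`-equivariant homomorphism on geometric points with finite kernel), so it holds at Kato's member
  `W_K ∼ W` of every potentially supersingular row (where the closers of M apply `hImai`);
* §3 the rows: `…_of_classO6` (ALL K9 rows: wild `3`, `ClassO6.not_typeG_three` + Deuring), `…_of_classO5` and
  `…_of_subTprime` (ALL K8-t′ rows: `ClassO5 ⊇ Addv ∧ SubTprime`, `not_hasUnitRootAt_baseChange_of_classO5`), each also
  at every isogenous member.

HONEST FRAMING.  Theorems only (no definition, no named fact, no `sorry`); route-free (imports no K9/K8-t′ `Theses.*`);
closes nothing by itself; BSD is proved for no curve.  What changes: the trust base of crux M (and of U₀-red) ON THE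
ROUTES' ROWS loses Imai — see the sibling file `…ReducibleKatoMemberOfFineInputsPotSupersingular.lean` (this seat) for
the row-level closers from {modularity, Fine, H2X⁺, FW, Lim} alone.  The Imai NAMED FACT itself (all potentially good
`p`, including the potentially ORDINARY additive rows and `p = 2`) is NOT discharged here.

References: [Serre1967GroupesPDivisibles] §5 Prop. 8, Lemme 3; [Imai1975] Theorem (p. 12); [GreenbergLNM1716] §3
Lemma 3.3 (p. 87); [SilvermanAEC2009] III.4 (isogenies), Cor. III.8.1.1, VII.5.5; [Kato2004Asterisque] (12.5.1),
Rem. 12.7 (p. 222), (14.9.1) (p. 239); tree: `PotentiallySupersingularLocalTowerTorsionFinite{,Holds}.lean` (kmc g17 /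
bsd-wall utd-p3 g5), `LocalTowerTorsionFiniteOfNoStableDivisibleLine.lean`, `LocalTowerMovesPTorsionOfNoRootsOfUnity.lean`
(kmc g16), `AdditivePotSupersingularControlOfFacts.lean` (`not_hasUnitRootAt_baseChange_of_classO5`),
`KatoDescentPotSupersingularTowerTorsionVanishing.lean` (rkm g26: the `= 0` form on the rows with `W(ℚ_p)[p] = 0`).
-/

-- the summit and its single problem are both named `BirchSwinnertonDyer` (registry layout D-0017)
set_option linter.dupNamespace false
set_option autoImplicit false

noncomputable section

open scoped Classical NumberField
open Function Field NumberField IsDedekindDomain WeierstrassCurve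
open Literature.NumberTheory.EllipticCurves Literature.NumberTheory.EllipticCurves.GreenbergSelmer
open Literature.NumberTheory.GaloisRepresentations
open Literature.NumberTheory.EllipticCurves.Rank1Residual
open Summit.BirchSwinnertonDyer.Rank1Residual Summit.BirchSwinnertonDyer.Rank1Residual.Additive
open Summit.BirchSwinnertonDyer.BirchSwinnertonDyer.Theorems.SchneiderFreeControlAtoms
open Summit.BirchSwinnertonDyer.BirchSwinnertonDyer.Theorems.PotentiallySupersingularLocalTorsion
open Summit.BirchSwinnertonDyer.BirchSwinnertonDyer.Theorems.AdditivePotSupersingularControl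

namespace Summit.BirchSwinnertonDyer.BirchSwinnertonDyer.Theorems.TowerTorsionFinite

/-! ## §1 The `ℚ`-level dialect: Fin_v at a potentially supersingular odd prime, every `ℤ_p`-extension -/

/-- Transport of the «no stable divisible line» statement along an EQUALITY of Weierstrass curves (used for
`W.baseChange ℚ = W`). [folklore] -/
private theorem noStableDivisibleLine_of_eq {K : Type} [Field K] [NumberField K] {E E' : WeierstrassCurve K}
    (h : E = E') (p : ℕ) (𝔭 : HeightOneSpectrum (𝓞 K))
    (hE : ∀ N : AddSubgroup (E.geomPrimaryTorsion p),
      (∀ d ∈ decomp 𝔭, ∀ c ∈ N, d • c ∈ N) → (∀ c ∈ N, ∃ c' ∈ N, p • c' = c) →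
      Set.ncard {c : E.geomPrimaryTorsion p | c ∈ N ∧ p • c = 0} ≤ p → N = ⊥) :
    ∀ N : AddSubgroup (E'.geomPrimaryTorsion p),
      (∀ d ∈ decomp 𝔭, ∀ c ∈ N, d • c ∈ N) → (∀ c ∈ N, ∃ c' ∈ N, p • c' = c) →
      Set.ncard {c : E'.geomPrimaryTorsion p | c ∈ N ∧ p • c = 0} ≤ p → N = ⊥ := by
  subst h
  exact hE

/-- `W.baseChange ℚ = W` (the `ℚ`-algebra structure of `ℚ` is the identity; `WeierstrassCurve.map_id`). [folklore] -/
theorem baseChange_rat_eq (W : WeierstrassCurve ℚ) : W.baseChange ℚ = W := by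
  change W.map (algebraMap ℚ ℚ) = W
  rw [Subsingleton.elim (algebraMap ℚ ℚ) (RingHom.id ℚ), WeierstrassCurve.map_id]

/-- **At the place `v` of `ℚ` above an ODD `p`, the local tower group `D_v ⊓ ker κ` of ANY `ℤ_p`-extension moves a
`p`-torsion point of `E(ℚ̄)`** (`ℚ_v ≃ ℚ_p` has no primitive `p`-th root of unity for `p` odd; Weil pairing — kmc g16's
`exists_pTorsion_not_fixed_of_no_primitiveRoot` at `K = ℚ`). [cite: SilvermanAEC2009, Cor. III.8.1.1]
[cite: Serre1973, Ch. II §3.1 Prop. 7] -/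
theorem exists_pTorsion_not_fixed_rat (W : WeierstrassCurve ℚ) [W.IsElliptic] (p : ℕ) [Fact p.Prime]
    (hp2 : p ≠ 2) (κ : ZpExtension ℚ p) (v : HeightOneSpectrum (𝓞 ℚ))
    (hv : ((Rat.HeightOneSpectrum.primesEquiv v : Nat.Primes) : ℕ) = p) :
    ∃ m : W.geomPrimaryTorsion p, p • m = 0 ∧ ∃ g ∈ decomp v ⊓ κ.kerSubgroup, g • m ≠ m := by
  subst hv
  have hpr : ((Rat.HeightOneSpectrum.primesEquiv v : Nat.Primes) : ℕ).Prime := Fact.out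
  refine W.exists_pTorsion_not_fixed_of_no_primitiveRoot _ κ v fun z hz ↦ ?_
  set e : v.adicCompletion ℚ →ₐ[ℚ] ℚ_[((Rat.HeightOneSpectrum.primesEquiv v : Nat.Primes) : ℕ)] :=
    (Rat.HeightOneSpectrum.adicCompletion.padicEquiv (R := 𝓞 ℚ) v).toAlgEquiv.toAlgHom with he
  have hinj : Function.Injective e :=
    (Rat.HeightOneSpectrum.adicCompletion.padicEquiv (R := 𝓞 ℚ) v).toAlgEquiv.injective
  have hz' : IsPrimitiveRoot (e z) _ := hz.map_of_injective hinj
  have hdvd := (Literature.AnabelianGeometry.EtaleTheta.exists_isPrimitiveRoot_padic_iff_dvd_pred _ hp2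
    hpr.ne_zero).mp ⟨e z, hz'⟩
  have hle := Nat.le_of_dvd (by have := hpr.two_le; omega) hdvd
  have := hpr.two_le
  omega

/-- **Imai's finiteness at a potentially SUPERSINGULAR odd prime, `ℚ`-level dialect, EVERY `ℤ_p`-extension.**  For an
elliptic curve `W/ℚ`, an odd prime `p` with `0 ≤ ord_p j(W)` such that the unit-root condition FAILS at every place of
good reduction above `p` of every number field (potentially supersingular reduction), every `ℤ_p`-extension `κ` of `ℚ`
and the place `v` of `ℚ` at `p`: the points of `W(ℚ̄)[p^∞]` fixed by `ker κ ⊓ D_v` — `W(ℚ_{∞,v})[p^∞]` — form a FINITE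
group.  VERBATIM the conclusion of the Imai fact `imai1975_finite_fixedPoints_kerSubgroup_inf_decomp_of_padicValRat_j_nonneg`
and the hypothesis `hfin` of `Kato2004.exists_iwasawaH2Data_fineSelmerDual_embedding{,_count}` on these rows.  Proof:
kmc's line-free reduction at `K = ℚ`, `E = W`, with (i) no `D_v`-stable divisible line (Serre 1967 Prop. 8, tree
theorem, read through `W.baseChange ℚ = W`) and (ii) a `p`-torsion point moved by the tower group (`μ_p ⊄ ℚ_p`).
[cite: Serre1967GroupesPDivisibles, §5 Prop. 8] [cite: Imai1975, Theorem (p. 12)]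
[cite: GreenbergLNM1716, §3 Lemma 3.3 (p. 87)] -/
theorem finite_fixedPoints_kerSubgroup_inf_decomp_of_potentiallySupersingular
    (W : WeierstrassCurve ℚ) [W.IsElliptic] (p : ℕ) [Fact p.Prime] (hp2 : p ≠ 2)
    (hj : 0 ≤ padicValRat p W.j)
    (hss : ∀ (F : Type) [Field F] [NumberField F] (w : HeightOneSpectrum (𝓞 F)),
      ((p : ℕ) : 𝓞 F) ∈ w.asIdeal → (W.baseChange F).HasGoodReductionAt w →
        ¬ (W.baseChange F).HasUnitRootAt w)
    (κ : ZpExtension ℚ p) (v : HeightOneSpectrum (𝓞 ℚ))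
    (hv : ((Rat.HeightOneSpectrum.primesEquiv v : Nat.Primes) : ℕ) = p) :
    Finite (FixedPoints.addSubgroup ↥(κ.kerSubgroup ⊓ decomp v) (W.geomPrimaryTorsion p)) := by
  have hpr : p.Prime := Fact.out
  have hpv : ((p : ℕ) : 𝓞 ℚ) ∈ v.asIdeal :=
    (natCast_mem_asIdeal_iff_eq_primesEquiv_symm v hpr).mpr
      ((Equiv.eq_symm_apply _).mpr (Subtype.ext hv))
  -- (i) no stable divisible line: Serre 1967 Prop. 8 at `K = ℚ`, read through `W.baseChange ℚ = W`
  have hline := noStableDivisibleLine_of_eq (baseChange_rat_eq W) p v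
    (Serre1967.noStableDivisibleLine_of_potentiallySupersingular_holds W p hj hss ℚ v hpv)
  -- (ii) the tower group moves a `p`-torsion point; then kmc's line-free reduction
  have hfin := W.localTowerTorsionFiniteAt_of_noStableDivisibleLine p κ v hline
    (exists_pTorsion_not_fixed_rat W p hp2 κ v hv)
  unfold LocalTowerTorsionFiniteAt at hfin
  rw [inf_comm]
  exact hfin.to_subtype

/-- The same finiteness in the number-field dialect `SchneiderFreeControlAtoms.LocalTowerTorsionFiniteAt W p κ v` at
`K = ℚ` (no `baseChange`). [cite: Serre1967GroupesPDivisibles, §5 Prop. 8] [cite: GreenbergLNM1716, §3 Lemma 3.3 (p. 87)] -/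
theorem localTowerTorsionFiniteAt_rat_of_potentiallySupersingular
    (W : WeierstrassCurve ℚ) [W.IsElliptic] (p : ℕ) [Fact p.Prime] (hp2 : p ≠ 2)
    (hj : 0 ≤ padicValRat p W.j)
    (hss : ∀ (F : Type) [Field F] [NumberField F] (w : HeightOneSpectrum (𝓞 F)),
      ((p : ℕ) : 𝓞 F) ∈ w.asIdeal → (W.baseChange F).HasGoodReductionAt w →
        ¬ (W.baseChange F).HasUnitRootAt w)
    (κ : ZpExtension ℚ p) (v : HeightOneSpectrum (𝓞 ℚ))
    (hv : ((Rat.HeightOneSpectrum.primesEquiv v : Nat.Primes) : ℕ) = p) :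
    LocalTowerTorsionFiniteAt W p κ v := by
  have hpr : p.Prime := Fact.out
  have hpv : ((p : ℕ) : 𝓞 ℚ) ∈ v.asIdeal :=
    (natCast_mem_asIdeal_iff_eq_primesEquiv_symm v hpr).mpr
      ((Equiv.eq_symm_apply _).mpr (Subtype.ext hv))
  exact W.localTowerTorsionFiniteAt_of_noStableDivisibleLine p κ v
    (noStableDivisibleLine_of_eq (baseChange_rat_eq W) p v
      (Serre1967.noStableDivisibleLine_of_potentiallySupersingular_holds W p hj hss ℚ v hpv))
    (exists_pTorsion_not_fixed_rat W p hp2 κ v hv)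

/-! ## §2 Transport along a `ℚ`-isogeny (Kato's member `W_K ∼ W`) -/

/-- Fibres of a homomorphism with finite kernel are finite. [folklore] -/
private theorem finite_preimage_singleton {A B : Type*} [AddCommGroup A] [AddCommGroup B] (f : A →+ B)
    (hker : (f.ker : Set A).Finite) (b : B) : (f ⁻¹' {b}).Finite := by
  by_cases h : ∃ a, f a = b
  · obtain ⟨a, ha⟩ := h
    refine (hker.image fun x ↦ x + a).subset ?_
    intro x hx
    rw [Set.mem_preimage, Set.mem_singleton_iff] at hx
    refine ⟨x - a, ?_, by simp only [sub_add_cancel]⟩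
    rw [SetLike.mem_coe, AddMonoidHom.mem_ker, map_sub, hx, ha, sub_self]
  · have he : f ⁻¹' {b} = ∅ := by
      ext x
      simp only [Set.mem_preimage, Set.mem_singleton_iff, Set.mem_empty_iff_false, iff_false]
      exact fun hx ↦ h ⟨x, hx⟩
    rw [he]
    exact Set.finite_empty

/-- **Finiteness of the `H`-fixed `p`-primary torsion transports along an isogeny** (any field `K`, any subgroup
`H ≤ Γ_K`): for an isogeny `ψ : E₁ → E₂` over `K` — a `Γ_K`-equivariant homomorphism `E₁(K̄) → E₂(K̄)` with finite
kernel — `ψ` maps `E₁[p^∞]^H` into `E₂[p^∞]^H` with finite fibres, so the former is finite when the latter is.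
[cite: SilvermanAEC2009, III.4 (isogenies; Thm. III.4.8, Cor. III.4.9)] -/
theorem finite_fixedPoints_of_isogeny {K : Type} [Field K] {W₁ W₂ : WeierstrassCurve K} (ψ : Isogeny W₁ W₂)
    (p : ℕ) (H : Subgroup (absoluteGaloisGroup K))
    (h₂ : Finite (FixedPoints.addSubgroup H (W₂.geomPrimaryTorsion p))) :
    Finite (FixedPoints.addSubgroup H (W₁.geomPrimaryTorsion p)) := by
  set B₁ := FixedPoints.addSubgroup H (W₁.geomPrimaryTorsion p) with hB₁
  set B₂ := FixedPoints.addSubgroup H (W₂.geomPrimaryTorsion p) with hB₂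
  -- the image of `B₂` in `E₂(K̄)`, a finite set, and its preimage under `ψ`, a finite set
  set T : Set W₂.geomPoints :=
    (fun m : W₂.geomPrimaryTorsion p ↦ (m : W₂.geomPoints)) '' (B₂ : Set (W₂.geomPrimaryTorsion p)) with hT
  have hB₂fin : (B₂ : Set (W₂.geomPrimaryTorsion p)).Finite := Set.toFinite _
  have hTfin : T.Finite := hB₂fin.image _
  have hpre : ((fun x : W₁.geomPoints ↦ ψ x) ⁻¹' T).Finite :=
    hTfin.preimage' fun b _ ↦ finite_preimage_singleton ψ.toAddMonoidHom ψ.finite_ker b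
  -- `B₁` injects into that preimage along the coercion `E₁[p^∞] → E₁(K̄)`
  have hB₁fin : (B₁ : Set (W₁.geomPrimaryTorsion p)).Finite := by
    refine Set.Finite.of_finite_image (f := fun m : W₁.geomPrimaryTorsion p ↦ (m : W₁.geomPoints)) ?_
      Subtype.coe_injective.injOn
    refine hpre.subset ?_
    rintro _ ⟨m, hm, rfl⟩
    -- `ψ m` is `p`-primary torsion and `H`-fixed
    have hmem : ψ (m : W₁.geomPoints) ∈ W₂.geomPrimaryTorsion p := by
      obtain ⟨k, hk⟩ := (AddCommGroup.mem_primaryComponent).mp m.2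
      refine (AddCommGroup.mem_primaryComponent).mpr ⟨k, ?_⟩
      rw [← map_nsmul, hk, map_zero]
    have hfix : (⟨ψ (m : W₁.geomPoints), hmem⟩ : W₂.geomPrimaryTorsion p) ∈ B₂ := by
      rw [hB₂, FixedPoints.mem_addSubgroup]
      rintro ⟨g, hg⟩
      apply Subtype.ext
      have hgm : g • m = m := by
        have h := hm
        rw [SetLike.mem_coe, hB₁, FixedPoints.mem_addSubgroup] at h
        have h' := h ⟨g, hg⟩
        rwa [Subgroup.mk_smul] at h'
      have hgm' : g • (m : W₁.geomPoints) = m := by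
        rw [← primaryComponent.coe_smul, hgm]
      rw [Subgroup.mk_smul, primaryComponent.coe_smul]
      change g • ψ (m : W₁.geomPoints) = ψ (m : W₁.geomPoints)
      rw [← ψ.map_smul, hgm']
    exact ⟨⟨ψ (m : W₁.geomPoints), hmem⟩, hfix, rfl⟩
  exact hB₁fin.to_subtype

/-- **The same transport along `IsIsogenous` in characteristic `0`** (elliptic curves; the reverse isogeny exists,
Silverman III.6.1 (a)): `E₁ ∼ E₂` and `E₁[p^∞]^H` finite ⟹ `E₂[p^∞]^H` finite. [cite: SilvermanAEC2009, Thm. III.6.1 (a)] -/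
theorem finite_fixedPoints_of_isIsogenous {K : Type} [Field K] [CharZero K] {W₁ W₂ : WeierstrassCurve K}
    [W₁.IsElliptic] [W₂.IsElliptic] (hiso : IsIsogenous W₁ W₂) (p : ℕ) (H : Subgroup (absoluteGaloisGroup K))
    (h₁ : Finite (FixedPoints.addSubgroup H (W₁.geomPrimaryTorsion p))) :
    Finite (FixedPoints.addSubgroup H (W₂.geomPrimaryTorsion p)) := by
  obtain ⟨ψ⟩ := hiso.symm_of_charZero
  exact finite_fixedPoints_of_isogeny ψ p H h₁

/-- **Imai's finiteness at every curve `ℚ`-ISOGENOUS to a potentially supersingular one** (odd `p`, any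
`ℤ_p`-extension) — the form used at Kato's member `W_K ∼ W` by the closers of crux M.
[cite: Serre1967GroupesPDivisibles, §5 Prop. 8] [cite: SilvermanAEC2009, Thm. III.6.1 (a)] [cite: Imai1975, Theorem (p. 12)] -/
theorem finite_fixedPoints_kerSubgroup_inf_decomp_of_isIsogenous_of_potentiallySupersingular
    (W : WeierstrassCurve ℚ) [W.IsElliptic] (p : ℕ) [Fact p.Prime] (hp2 : p ≠ 2)
    (hj : 0 ≤ padicValRat p W.j)
    (hss : ∀ (F : Type) [Field F] [NumberField F] (w : HeightOneSpectrum (𝓞 F)),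
      ((p : ℕ) : 𝓞 F) ∈ w.asIdeal → (W.baseChange F).HasGoodReductionAt w →
        ¬ (W.baseChange F).HasUnitRootAt w)
    {W' : WeierstrassCurve ℚ} [W'.IsElliptic] (hiso : IsIsogenous W W')
    (κ : ZpExtension ℚ p) (v : HeightOneSpectrum (𝓞 ℚ))
    (hv : ((Rat.HeightOneSpectrum.primesEquiv v : Nat.Primes) : ℕ) = p) :
    Finite (FixedPoints.addSubgroup ↥(κ.kerSubgroup ⊓ decomp v) (W'.geomPrimaryTorsion p)) :=
  finite_fixedPoints_of_isIsogenous hiso p _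
    (finite_fixedPoints_kerSubgroup_inf_decomp_of_potentiallySupersingular W p hp2 hj hss κ v hv)

/-! ## §3 The rows of the two routes: ALL of K9 (`ClassO6 W 3`) and ALL of K8-t′ (`Addv ∧ SubTprime ⊆ ClassO5`) -/

/-- **ALL K9 rows (the wild class O6 at `3`), every isogenous member, every `ℤ₃`-extension**: Imai's finiteness
`Finite (W'[3^∞]^{ker κ ⊓ D_v})`.  `ord₃ j ≥ 0` is `ClassO6.padicValRat_j_nonneg`; potentially supersingular by
`ClassO6.not_typeG_three` + Deuring (`not_hasUnitRootAt_baseChange_of_not_typeG_three`).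
[cite: Serre1967GroupesPDivisibles, §5 Prop. 8] [cite: Delbourgo1998, §1.5 (G)] [cite: Imai1975, Theorem (p. 12)] -/
theorem finite_fixedPoints_kerSubgroup_inf_decomp_of_classO6
    (W : WeierstrassCurve ℚ) [W.IsElliptic] [W.IsGloballyMinimal] [Fact (3 : ℕ).Prime] (hO6 : ClassO6 W 3)
    {W' : WeierstrassCurve ℚ} [W'.IsElliptic] (hiso : IsIsogenous W W')
    (κ : ZpExtension ℚ 3) (v : HeightOneSpectrum (𝓞 ℚ))
    (hv : ((Rat.HeightOneSpectrum.primesEquiv v : Nat.Primes) : ℕ) = 3) :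
    Finite (FixedPoints.addSubgroup ↥(κ.kerSubgroup ⊓ decomp v) (W'.geomPrimaryTorsion 3)) :=
  finite_fixedPoints_kerSubgroup_inf_decomp_of_isIsogenous_of_potentiallySupersingular W 3 (by decide)
    hO6.padicValRat_j_nonneg
    (fun _F _ _ _w hw hgood ↦
      not_hasUnitRootAt_baseChange_of_not_typeG_three W hO6.2.1 hO6.not_typeG_three.1 hw hgood)
    hiso κ v hv

/-- **ALL rows of the tame class O5 (odd `p`), every isogenous member, every `ℤ_p`-extension**: Imai's finiteness.
`ord_p j ≥ 0` is `ClassO5.padicValRat_j_nonneg`; potentially supersingular by `not_hasUnitRootAt_baseChange_of_classO5`.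
[cite: Serre1967GroupesPDivisibles, §5 Prop. 8] [cite: Delbourgo1998, §1.5 (G) and Thm. 1 p. 152] [cite: Imai1975, Theorem (p. 12)] -/
theorem finite_fixedPoints_kerSubgroup_inf_decomp_of_classO5
    (W : WeierstrassCurve ℚ) [W.IsElliptic] [W.IsGloballyMinimal] (p : ℕ) [Fact p.Prime] (hO5 : ClassO5 W p)
    {W' : WeierstrassCurve ℚ} [W'.IsElliptic] (hiso : IsIsogenous W W')
    (κ : ZpExtension ℚ p) (v : HeightOneSpectrum (𝓞 ℚ))
    (hv : ((Rat.HeightOneSpectrum.primesEquiv v : Nat.Primes) : ℕ) = p) :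
    Finite (FixedPoints.addSubgroup ↥(κ.kerSubgroup ⊓ decomp v) (W'.geomPrimaryTorsion p)) :=
  finite_fixedPoints_kerSubgroup_inf_decomp_of_isIsogenous_of_potentiallySupersingular W p hO5.1
    hO5.padicValRat_j_nonneg
    (fun _F _ _ _w hw hgood ↦ not_hasUnitRootAt_baseChange_of_classO5 W p hO5 hw hgood)
    hiso κ v hv

/-- **ALL K8-t′ rows (odd additive `p` of census cell (t′): `Addv W p ∧ SubTprime W p`), every isogenous member,
every `ℤ_p`-extension**: Imai's finiteness (the (t′) cell lies in the tame potentially supersingular class O5).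
[cite: Serre1967GroupesPDivisibles, §5 Prop. 8] [cite: Delbourgo1998, §1.5 (G)] [cite: Imai1975, Theorem (p. 12)] -/
theorem finite_fixedPoints_kerSubgroup_inf_decomp_of_subTprime
    (W : WeierstrassCurve ℚ) [W.IsElliptic] [W.IsGloballyMinimal] (p : ℕ) [Fact p.Prime] (hp2 : p ≠ 2)
    (hadd : Addv W p) (hT : SubTprime W p)
    {W' : WeierstrassCurve ℚ} [W'.IsElliptic] (hiso : IsIsogenous W W')
    (κ : ZpExtension ℚ p) (v : HeightOneSpectrum (𝓞 ℚ))
    (hv : ((Rat.HeightOneSpectrum.primesEquiv v : Nat.Primes) : ℕ) = p) :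
    Finite (FixedPoints.addSubgroup ↥(κ.kerSubgroup ⊓ decomp v) (W'.geomPrimaryTorsion p)) :=
  finite_fixedPoints_kerSubgroup_inf_decomp_of_classO5 W p ⟨hp2, hadd, Or.inr hT⟩ hiso κ v hv

end Summit.BirchSwinnertonDyer.BirchSwinnertonDyer.Theorems.TowerTorsionFinite

end
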